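import Mathlib
import Summits.Schanuel.Schanuel.Theorems.RootDecomp1EModuleGridsSharp

-- `Summit.Schanuel.Schanuel.…` is the mandated layout of this single-problem summit (CONVENTIONS §1).
set_option linter.dupNamespace false

/-!
# RootDecomp1E — lens 2, gen 8 «ModuleGrids» (cells, part 2/2 = §4): the certified cell `z★` (§3 `z♯` in `RootDecomp1EModuleGridsSharp`; importers use this file)

Two certified members of the hypothesis class of `RootDecomp1E.PlainDefectOne` (stmt-Schanuel-31410) at its
first open length `n = 3` on which its conclusion `S⁻` is PROVED (mod the tree theorem
`smallTrdeg_thm_2_9_two_two` = Brownawell–Waldschmidt), by the twisted-log-pair cell of part 1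
(`Theorems.RootDecomp1EModuleGrids.two_le_trdeg_of_twistedLogPair`):
* §3 `z♯ = (log 2, π·log 2, iπ²)` — ℚ-free, NO irrational multiplier (plain), sub-minimal; two of
  `log 2, π, 2^π, e^{iπ²}` are algebraically independent; the B–W corner `iπ ∉ span_ℚ z♯`;
* §4 `z★ = (log 2, log 3, iπ·log 3/log 2)` — same certificates (`log 3/log 2 ∉ ℚ`); two of
  `log 2, log 3, π, e^{iπ log 3/log 2}` are algebraically independent, over the OPEN pair `(log 2, log 3)`.
Sorry-free; axioms `propext`, `Classical.choice`, `Quot.sound`.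
[cite: BakerTNT1975, Ch. 12 Theorem 12.2]
-/

noncomputable section

namespace Summit.Schanuel.Schanuel.Theorems.RootDecomp1EModuleGrids

open Complex IntermediateField
open Summit.Schanuel.Schanuel.Theorems.RootDecomp1EAnchor (isAlgebraic_of_mem_adjoin
  trdeg_adjoin_le_of_isAlgebraic mem_adjoin_of_mem_span exp_isAlgebraic_of_mem_span trdeg_le_of_mem_span)
open Literature.Barriers.Schanuel (gridField₂ smallTrdeg_thm_2_9_two_two trdeg_mono)
open Summit.Schanuel.Schanuel.Theorems.RootDecomp1EEStableRung (defectOne_of_le_two)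

/-! ## §4 The certified instance `z★ = (log 2, log 3, iπ·log 3 / log 2)` -/

/-- `log 3` as a complex number. -/
def L3 : ℂ := ((Real.log 3 : ℝ) : ℂ)

/-- `log 3 ≠ 0`. -/
theorem log_three_ne_zero : Real.log 3 ≠ 0 := (Real.log_pos (by norm_num)).ne'

/-- `θ = log 3 / log 2`. -/
def θ : ℝ := Real.log 3 / Real.log 2

/-- `θ · log 2 = log 3`. -/
theorem θ_mul_log_two : θ * Real.log 2 = Real.log 3 := by
  rw [θ, div_mul_cancel₀ _ log_two_ne_zero]

/-- `θ ≠ 0`. -/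
theorem θ_ne_zero : θ ≠ 0 := div_ne_zero log_three_ne_zero log_two_ne_zero

/-- `t·θ = r` with `t, r ∈ ℚ` forces `t = r = 0` (`log 3 / log 2 ∉ ℚ`). -/
theorem rat_mul_θ_eq_rat {t r : ℚ} (h : (t : ℝ) * θ = r) : t = 0 ∧ r = 0 := by
  have h' : (r : ℝ) * Real.log 2 = (t : ℝ) * Real.log 3 := by
    rw [← θ_mul_log_two, ← h]; ring
  obtain ⟨hr, ht⟩ := rat_mul_log_two_eq_rat_mul_log_three h'
  exact ⟨ht, hr⟩

/-- **`z★ = (log 2, log 3, iπ·log 3/log 2)`.** -/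
def zStar : Fin 3 → ℂ := ![L2, L3, ((θ * Real.pi : ℝ) : ℂ) * I]

/-- `e^{log 3} = 3`. -/
theorem exp_L3 : cexp L3 = 3 := by
  rw [L3, ← Complex.ofReal_exp, Real.exp_log (by norm_num : (0 : ℝ) < 3)]
  norm_num

/-- `z★` is ℚ-free (`log 3/log 2 ∉ ℚ` for the real part, `θπ ≠ 0` for the imaginary part). -/
theorem zStar_linearIndependent : LinearIndependent ℚ zStar := by
  rw [Fintype.linearIndependent_iff]
  intro g hg
  simp only [Fin.sum_univ_three, zStar, Matrix.cons_val_zero, Matrix.cons_val_one,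
    Matrix.cons_val_two, Matrix.tail_cons, Matrix.head_cons, Rat.smul_def] at hg
  have hre := congrArg Complex.re hg
  have him := congrArg Complex.im hg
  simp only [L2, L3, Complex.add_re, Complex.add_im, Complex.mul_re, Complex.mul_im, Complex.ofReal_re,
    Complex.ofReal_im, Complex.I_re, Complex.I_im, Complex.ratCast_re, Complex.ratCast_im,
    Complex.zero_re, Complex.zero_im, mul_zero, zero_mul, sub_zero, add_zero, zero_add, mul_one,
    sub_self] at hre him
  have h2 : g 2 = 0 := by
    have h : (g 2 : ℝ) * (θ * Real.pi) = 0 := by linear_combination him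
    rcases mul_eq_zero.mp h with h | h
    · exact_mod_cast h
    · exact absurd h (mul_ne_zero θ_ne_zero Real.pi_ne_zero)
  obtain ⟨h0, h1⟩ := rat_log_two_log_three_indep
    (show (g 0 : ℝ) * Real.log 2 + (g 1 : ℝ) * Real.log 3 = 0 by linear_combination hre)
  intro i
  fin_cases i
  · exact h0
  · exact h1
  · exact h2

/-- **`z★` has NO irrational multiplier** (hence is PLAIN): uses only `log 3/log 2 ∉ ℚ`. -/
theorem zStar_multiplier_rational (β : ℂ) (hβ : ∀ i, β * zStar i ∈ Submodule.span ℚ (Set.range zStar)) :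
    β ∈ Set.range (algebraMap ℚ ℂ) := by
  obtain ⟨a, ha⟩ := (Submodule.mem_span_range_iff_exists_fun ℚ).mp (hβ 0)
  obtain ⟨b, hb⟩ := (Submodule.mem_span_range_iff_exists_fun ℚ).mp (hβ 1)
  obtain ⟨c, hc⟩ := (Submodule.mem_span_range_iff_exists_fun ℚ).mp (hβ 2)
  simp only [Fin.sum_univ_three, zStar, Matrix.cons_val_zero, Matrix.cons_val_one,
    Matrix.cons_val_two, Matrix.tail_cons, Matrix.head_cons, Rat.smul_def] at ha hb hc
  have hπ : Real.pi ≠ 0 := Real.pi_ne_zero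
  have ha_re := congrArg Complex.re ha
  have ha_im := congrArg Complex.im ha
  have hb_im := congrArg Complex.im hb
  have hc_im := congrArg Complex.im hc
  simp only [L2, L3, Complex.add_re, Complex.add_im, Complex.mul_re, Complex.mul_im, Complex.ofReal_re,
    Complex.ofReal_im, Complex.I_re, Complex.I_im, Complex.ratCast_re, Complex.ratCast_im,
    mul_zero, zero_mul, sub_zero, add_zero, zero_add, mul_one,
    sub_self] at ha_re ha_im hb_im hc_im
  -- hc_im : c 2 θπ = βr θπ ⇒ βr = c 2
  have hβr : β.re = (c 2 : ℝ) := by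
    have h : (β.re - (c 2 : ℝ)) * (θ * Real.pi) = 0 := by linear_combination -hc_im
    have := (mul_eq_zero.mp h).resolve_right (mul_ne_zero θ_ne_zero hπ)
    linear_combination this
  -- ha_re : a 0 log 2 + a 1 log 3 = βr log 2 ⇒ (c 2 - a 0) log 2 = a 1 log 3 ⇒ a 1 = 0
  have h01 : ((c 2 - a 0 : ℚ) : ℝ) * Real.log 2 = (a 1 : ℝ) * Real.log 3 := by
    push_cast; rw [← hβr]; linear_combination -ha_re
  obtain ⟨_, _⟩ := rat_mul_log_two_eq_rat_mul_log_three h01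
  -- ha_im : a 2 θπ = βi log 2 ; hb_im : b 2 θπ = βi log 3
  have hi2 : β.im * Real.log 2 = (a 2 : ℝ) * (θ * Real.pi) := by linear_combination -ha_im
  have hi3 : β.im * Real.log 3 = (b 2 : ℝ) * (θ * Real.pi) := by linear_combination -hb_im
  have hmix : β.im * ((b 2 : ℝ) * Real.log 2 - (a 2 : ℝ) * Real.log 3) = 0 := by
    linear_combination (b 2 : ℝ) * hi2 - (a 2 : ℝ) * hi3
  have hβi : β.im = 0 := by
    rcases mul_eq_zero.mp hmix with h | h
    · exact h
    · have h' : (b 2 : ℝ) * Real.log 2 = (a 2 : ℝ) * Real.log 3 := by linear_combination h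
      obtain ⟨hb2, _⟩ := rat_mul_log_two_eq_rat_mul_log_three h'
      have : β.im * Real.log 3 = 0 := by rw [hi3, hb2]; push_cast; ring
      exact (mul_eq_zero.mp this).resolve_right log_three_ne_zero
  refine ⟨c 2, ?_⟩
  apply Complex.ext
  · simp [hβr]
  · simp [hβi]

/-- `z★` is SUB-MINIMAL (automatic at length 3). -/
theorem zStar_subMinimal : ∀ (m : ℕ) (w : Fin m → ℂ), m < 3 → LinearIndependent ℚ w →
    (∀ j, w j ∈ Submodule.span ℚ (Set.range zStar)) →
    (m : Cardinal) ≤ Algebra.trdeg ℚ ↥(adjoin ℚ (Set.range w ∪ Set.range (cexp ∘ w))) + 1 :=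
  fun m w hm hw _ => defectOne_of_le_two m (by omega) w hw

/-- `θ · log 2 = log 3` in `ℂ`. -/
theorem θ_mul_L2 : ((θ : ℝ) : ℂ) * L2 = L3 := by
  rw [L2, L3, ← Complex.ofReal_mul, θ_mul_log_two]

/-- `θ = log 3 / log 2 ∈ K_{z★}`. -/
theorem θ_mem_adjoin_zStar : ((θ : ℝ) : ℂ) ∈ adjoin ℚ (Set.range zStar ∪ Set.range (cexp ∘ zStar)) := by
  have h0 : zStar 0 ∈ adjoin ℚ (Set.range zStar ∪ Set.range (cexp ∘ zStar)) :=
    subset_adjoin ℚ _ (Or.inl ⟨0, rfl⟩)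
  have h1 : zStar 1 ∈ adjoin ℚ (Set.range zStar ∪ Set.range (cexp ∘ zStar)) :=
    subset_adjoin ℚ _ (Or.inl ⟨1, rfl⟩)
  have : ((θ : ℝ) : ℂ) = zStar 1 * (zStar 0)⁻¹ := by
    simp only [zStar, Matrix.cons_val_zero, Matrix.cons_val_one]
    rw [← θ_mul_L2]
    field_simp [L2_ne_zero]
  rw [this]
  exact mul_mem h1 (inv_mem h0)

/-- `(1, θ)` is ℚ-free. -/
theorem linearIndependent_one_θ : LinearIndependent ℚ ![(1 : ℂ), ((θ : ℝ) : ℂ)] := by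
  rw [LinearIndependent.pair_iff]
  intro s t hst
  rw [Rat.smul_def, Rat.smul_def] at hst
  have hre := congrArg Complex.re hst
  simp only [Complex.add_re, Complex.mul_re, Complex.ofReal_re, Complex.ofReal_im,
    Complex.ratCast_re, Complex.ratCast_im, Complex.zero_re,
    mul_zero, sub_zero, mul_one] at hre
  have hre' : (t : ℝ) * θ = ((-s : ℚ) : ℝ) := by push_cast; linear_combination hre
  obtain ⟨ht, hs⟩ := rat_mul_θ_eq_rat hre'
  exact ⟨by simpa using hs, ht⟩

/-- `θ · log 2 ∈ span_ℚ z★`. -/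
theorem zStar_one_mem_span : ((θ : ℝ) : ℂ) * L2 ∈ Submodule.span ℚ (Set.range zStar) := by
  rw [θ_mul_L2]
  exact Submodule.subset_span ⟨1, by simp [zStar]⟩

/-- `θ · iπ ∈ span_ℚ z★`. -/
theorem zStar_two_mem_span : ((θ : ℝ) : ℂ) * (P * I) ∈ Submodule.span ℚ (Set.range zStar) := by
  have : ((θ : ℝ) : ℂ) * (P * I) = zStar 2 := by
    simp only [zStar, Matrix.cons_val_two, Matrix.tail_cons, Matrix.head_cons, P]
    push_cast
    ring
  rw [this]
  exact Submodule.subset_span ⟨2, rfl⟩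

/-- **DECIDED (mod B–W): `2 ≤ trdeg_ℚ ℚ(z★, e^{z★})`, i.e. two of `log 2, log 3, π, e^{iπ log 3/log 2}` are
algebraically independent** — although `SchanuelTwo` is OPEN at each of the three pairs of `z★`, in
particular at `(log 2, log 3)`.  Twisted log pair `l₁ = log 2`, `l₂ = iπ`, `μ = log 3/log 2`. -/
theorem two_le_trdeg_zStar (hBW : smallTrdeg_thm_2_9_two_two) :
    (2 : Cardinal) ≤ Algebra.trdeg ℚ ↥(adjoin ℚ (Set.range zStar ∪ Set.range (cexp ∘ zStar))) :=
  two_le_trdeg_of_twistedLogPair hBW zStar L2 (P * I) ((θ : ℝ) : ℂ) linearIndependent_L2_PI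
    linearIndependent_one_θ isAlgebraic_exp_L2 isAlgebraic_exp_P_mul_I θ_mem_adjoin_zStar
    zStar_one_mem_span zStar_two_mem_span

/-- **`S⁻` HOLDS AT `z★`** (conclusion of stmt-31410 at `n = 3`, `z = z★`), mod B–W. -/
theorem defectOne_zStar (hBW : smallTrdeg_thm_2_9_two_two) :
    ((3 : ℕ) : Cardinal) ≤ Algebra.trdeg ℚ ↥(adjoin ℚ (Set.range zStar ∪ Set.range (cexp ∘ zStar))) + 1 :=
  defectOne_three_of_twistedLogPair hBW zStar L2 (P * I) ((θ : ℝ) : ℂ) linearIndependent_L2_PI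
    linearIndependent_one_θ isAlgebraic_exp_L2 isAlgebraic_exp_P_mul_I θ_mem_adjoin_zStar
    zStar_one_mem_span zStar_two_mem_span

/-- The corner `iπ` of the configuration is NOT in `span_ℚ z★` either. -/
theorem PI_not_mem_span_zStar : P * I ∉ Submodule.span ℚ (Set.range zStar) := by
  intro h
  obtain ⟨c, hc⟩ := (Submodule.mem_span_range_iff_exists_fun ℚ).mp h
  simp only [Fin.sum_univ_three, zStar, Matrix.cons_val_zero, Matrix.cons_val_one,
    Matrix.cons_val_two, Matrix.tail_cons, Matrix.head_cons, Rat.smul_def] at hc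
  have him := congrArg Complex.im hc
  simp only [L2, L3, P, Complex.add_im, Complex.mul_re, Complex.mul_im, Complex.ofReal_re,
    Complex.ofReal_im, Complex.I_re, Complex.I_im, Complex.ratCast_re, Complex.ratCast_im,
    mul_zero, zero_mul, add_zero, zero_add, mul_one,
    sub_self] at him
  -- him : c 2 * (θ * π) = π
  have h1 : (c 2 : ℝ) * θ = ((1 : ℚ) : ℝ) := by
    have h : ((c 2 : ℝ) * θ - 1) * Real.pi = 0 := by linear_combination him
    have := (mul_eq_zero.mp h).resolve_right Real.pi_ne_zero
    push_cast; linear_combination this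
  obtain ⟨_, h10⟩ := rat_mul_θ_eq_rat h1
  exact one_ne_zero h10

end Summit.Schanuel.Schanuel.Theorems.RootDecomp1EModuleGrids
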